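import Literature.MathematicalPhysics.QuantumManyBody.JelliumPairBlocks
import HarnessLib

/-!
# The pair term of one pair `(i,j)`: lower bound keeping the condensate, `ŵ_{p0,q0}`, `ŵ_{p0,00}` and pairing blocks

Topic `Literature/MathematicalPhysics/QuantumManyBody` (the charged Bose gas, `JelliumBoseGas.foldyLaw`).
Assembly of [LiebSolovej2001, §5] for a single pair of particles, in first quantization: in the grouped
expansion `∫_{Λⁿ}w(xᵢ,xⱼ)|Ψ|² = D₀+D₁+D₂+D₃+2(R₀₁+R₀₂+R₀₃+R₁₂+R₁₃+R₂₃)` (`JelliumPairBlocks`) the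
blocks `D₀` (`ŵ_{00,00}`, Lemma 5.2), `D₁, D₂` (`ŵ_{p0,q0}`, Lemma 5.3), `R₀₁, R₀₂` (`ŵ_{p0,00}`,
Lemma 5.5 — to be combined with the background term) and the pairing block `R₀₃` (`ŵ_{pq,00}`, the
Bogoliubov term of §6) are KEPT; the exchange block `R₁₂` (Lemma 5.4) and the three-`Q` blocks
`R₁₃, R₂₃` (Lemma 5.6, Cauchy–Schwarz against the nonnegative quartic block `D₃`) are estimated:

`∫w|Ψ|² ≥ D₀ + D₁ + D₂ + 2(R₀₁ + R₀₂ + R₀₃) - (1 + ε⁻¹) ℓ⁻³M (‖PᵢQⱼΨ‖² + ‖QᵢPⱼΨ‖²)`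

for `0 < ε ≤ ½`, where `M` bounds the row and column integrals `∫_Λ w(x,y)dy`, `∫_Λ w(x,y)dx`
(`= 4πR²` for `w_{r,R}`; summed over pairs the error is the printed `ε⁻¹4πℓ⁻³R² n̂₀n̂₊`-type term).

* `sliceMean_update_of_update_invariant`, `sliceFluct_update_of_update_invariant` — `PᵢF`, `QᵢF`
  inherit independence of `xⱼ` (`i ≠ j`);
* `pair_lowerBound` — the displayed inequality.

## References

* [LiebSolovej2001] E. H. Lieb, J. P. Solovej, Commun. Math. Phys. 217 (2001) 127–163, Lemmas 5.4–5.6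
  (arXiv:cond-mat/0007425, pp. 12–13).
-/

noncomputable section

open MeasureTheory Set Filter Real
open scoped ENNReal NNReal Topology ComplexConjugate

namespace Literature.MathematicalPhysics.QuantumManyBody.JelliumBoseGas

open BoseGas

variable {n : ℕ} {ℓ : ℝ}

/-! ### Independence of a variable is inherited by `Pᵢ`, `Qᵢ` -/

/-- If `F` does not depend on `xⱼ` then neither does `PᵢF` (`i ≠ j`). [folklore] -/
theorem sliceMean_update_of_update_invariant (ℓ : ℝ) {i j : Fin n} (hij : i ≠ j) {F : Config n → ℂ}
    (hF : ∀ X z, F (Function.update X j z) = F X) (X : Config n) (z : Space) :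
    sliceMean ℓ i F (Function.update X j z) = sliceMean ℓ i F X := by
  unfold sliceMean
  congr 1
  funext y
  rw [Function.update_comm (Ne.symm hij), hF]

/-- If `F` does not depend on `xⱼ` then neither does `QᵢF` (`i ≠ j`). [folklore] -/
theorem sliceFluct_update_of_update_invariant (ℓ : ℝ) {i j : Fin n} (hij : i ≠ j) {F : Config n → ℂ}
    (hF : ∀ X z, F (Function.update X j z) = F X) (X : Config n) (z : Space) :
    sliceFluct ℓ i F (Function.update X j z) = sliceFluct ℓ i F X := by
  rw [sliceFluct, sliceFluct, hF, sliceMean_update_of_update_invariant ℓ hij hF]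

/-! ### The lower bound for one pair -/

/-- Arithmetic of the assembly. [folklore] -/
theorem pair_lowerBound_arith {E D0 D1 D2 D3 R01 R02 R03 R12 R13 R23 c N1 N2 ε : ℝ}
    (hE : E = D0 + D1 + D2 + D3 + 2 * (R01 + R02 + R03 + R12 + R13 + R23))
    (hD3 : 0 ≤ D3) (hε2 : ε ≤ 1 / 2)
    (h12 : 2 * |R12| ≤ c * (N1 + N2)) (h13 : 2 * |R13| ≤ ε * D3 + ε⁻¹ * (c * N1))
    (h23 : 2 * |R23| ≤ ε * D3 + ε⁻¹ * (c * N2)) :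
    D0 + D1 + D2 + 2 * (R01 + R02 + R03) - (1 + ε⁻¹) * c * (N1 + N2) ≤ E := by
  have a12 := neg_abs_le R12
  have a13 := neg_abs_le R13
  have a23 := neg_abs_le R23
  nlinarith

/-- **The pair term of one pair, lower bound** [LiebSolovej2001, Lemmas 5.4–5.6 in first
quantization]: for `ℓ > 0`, `i ≠ j`, a jointly measurable real weight `0 ≤ w ≤ W_b` whose row and
column integrals over `Λ` are `≤ M < ∞` (as `ℝ≥0∞` integrals of `ofReal w`), a continuous `Ψ` and
`0 < ε ≤ ½`, with the pieces `pc = ![PᵢPⱼΨ, PᵢQⱼΨ, QᵢPⱼΨ, QᵢQⱼΨ]`: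
`D₀ + D₁ + D₂ + 2(R₀₁ + R₀₂ + R₀₃) - (1 + ε⁻¹)ℓ⁻³M(‖pc 1‖² + ‖pc 2‖²) ≤ ∫_{Λⁿ} w(xᵢ,xⱼ)|Ψ|²`,
`D_α = ∫w|pc α|²`, `R_{αβ} = ∫wRe(conj(pc α) pc β)`, norms in `L²(Λⁿ)`.
[cite: LiebSolovej2001, Lemmas 5.4–5.6] -/
theorem pair_lowerBound (hℓ : 0 < ℓ) {i j : Fin n} (hij : i ≠ j) {w : Space → Space → ℝ}
    (hw : Measurable (Function.uncurry w)) (hw0 : ∀ x y, 0 ≤ w x y) {Wb : ℝ} (hWb : ∀ x y, |w x y| ≤ Wb)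
    {M : ℝ≥0∞} (hM : M ≠ ⊤) (hrow : ∀ x, ∫⁻ y in cell ℓ, ENNReal.ofReal (w x y) ≤ M)
    (hcol : ∀ y, ∫⁻ x in cell ℓ, ENNReal.ofReal (w x y) ≤ M)
    {Ψ : Config n → ℂ} (hΨ : Continuous Ψ) {ε : ℝ} (hε : 0 < ε) (hε2 : ε ≤ 1 / 2) :
    (∫ X in cellN n ℓ, w (X i) (X j) * ‖condensatePieces ℓ i j Ψ 0 X‖ ^ 2) +
      (∫ X in cellN n ℓ, w (X i) (X j) * ‖condensatePieces ℓ i j Ψ 1 X‖ ^ 2) +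
      (∫ X in cellN n ℓ, w (X i) (X j) * ‖condensatePieces ℓ i j Ψ 2 X‖ ^ 2) +
      2 * ((∫ X in cellN n ℓ, w (X i) (X j) *
              (conj (condensatePieces ℓ i j Ψ 0 X) * condensatePieces ℓ i j Ψ 1 X).re) +
           (∫ X in cellN n ℓ, w (X i) (X j) *
              (conj (condensatePieces ℓ i j Ψ 0 X) * condensatePieces ℓ i j Ψ 2 X).re) +
           (∫ X in cellN n ℓ, w (X i) (X j) *
              (conj (condensatePieces ℓ i j Ψ 0 X) * condensatePieces ℓ i j Ψ 3 X).re)) -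
      (1 + ε⁻¹) * ((ℓ ^ 3)⁻¹ * M.toReal) *
        ((∫⁻ X in cellN n ℓ, (‖condensatePieces ℓ i j Ψ 1 X‖₊ : ℝ≥0∞) ^ 2).toReal +
          (∫⁻ X in cellN n ℓ, (‖condensatePieces ℓ i j Ψ 2 X‖₊ : ℝ≥0∞) ^ 2).toReal) ≤
      ∫ X in cellN n ℓ, w (X i) (X j) * ‖Ψ X‖ ^ 2 := by
  set pc := condensatePieces ℓ i j Ψ with hpc
  -- the `ℝ≥0∞` weight
  set wE : Space → Space → ℝ≥0∞ := fun x y => ENNReal.ofReal (w x y) with hwE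
  have hwEm : Measurable (Function.uncurry wE) := ENNReal.measurable_ofReal.comp hw
  have hwEm' : Measurable (Function.uncurry fun x y => wE y x) :=
    ENNReal.measurable_ofReal.comp (hw.comp measurable_swap)
  have hwEij : Measurable fun X : Config n => wE (X i) (X j) := by
    have e : (fun X : Config n => wE (X i) (X j)) = Function.uncurry wE ∘ fun X : Config n => (X i, X j) := rfl
    rw [e]; exact hwEm.comp (by fun_prop)
  -- continuity and invariances of the pieces
  have hc : ∀ α, Continuous (pc α) := continuous_condensatePieces ℓ i j hΨ
  have hPj : ∀ X z, sliceMean ℓ j Ψ (Function.update X j z) = sliceMean ℓ j Ψ X := fun X z =>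
    sliceMean_update ℓ j Ψ X z
  have h2j : ∀ X z, pc 2 (Function.update X j z) = pc 2 X := fun X z => by
    simp only [hpc, condensatePieces_two]
    exact sliceFluct_update_of_update_invariant ℓ hij hPj X z
  have h1i : ∀ X z, pc 1 (Function.update X i z) = pc 1 X := fun X z => by
    simp only [hpc, condensatePieces_one]
    exact sliceMean_update ℓ i _ X z
  -- finiteness of the `L²` norms of the pieces
  have hNtop : ∀ α, (∫⁻ X in cellN n ℓ, (‖pc α X‖₊ : ℝ≥0∞) ^ 2) ≠ ⊤ := fun α =>
    (setLIntegral_cellN_normSq_lt_top (hc α) ℓ).ne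
  have hL3 : ENNReal.ofReal ℓ ^ 3 ≠ 0 := pow_ne_zero _ (by simpa using hℓ)
  have hcoef : ((ENNReal.ofReal ℓ ^ 3)⁻¹ * M) ≠ ⊤ := ENNReal.mul_ne_top (ENNReal.inv_ne_top.2 hL3) hM
  have hcoefr : ((ENNReal.ofReal ℓ ^ 3)⁻¹ * M).toReal = (ℓ ^ 3)⁻¹ * M.toReal := by
    rw [ENNReal.toReal_mul, ENNReal.toReal_inv, ENNReal.toReal_pow, ENNReal.toReal_ofReal hℓ.le]
  -- the expansion
  have hE := pair_expansion_grouped (ℓ := ℓ) hw hWb i j hΨ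
  -- the diagonal block `D₃ ≥ 0` and its `ℝ≥0∞` form
  have hD3 : 0 ≤ ∫ X in cellN n ℓ, w (X i) (X j) * ‖pc 3 X‖ ^ 2 :=
    integral_nonneg fun X => mul_nonneg (hw0 _ _) (sq_nonneg _)
  have hD3e := diag_block_eq_toReal (ℓ := ℓ) hw hw0 hWb i j (hc 3)
  -- (b12) the exchange block
  have h12 : 2 * |∫ X in cellN n ℓ, w (X i) (X j) * (conj (pc 1 X) * pc 2 X).re| ≤
      ((ℓ ^ 3)⁻¹ * M.toReal) * ((∫⁻ X in cellN n ℓ, (‖pc 1 X‖₊ : ℝ≥0∞) ^ 2).toReal +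
        (∫⁻ X in cellN n ℓ, (‖pc 2 X‖₊ : ℝ≥0∞) ^ 2).toReal) := by
    have ha := abs_offdiag_block_le_toReal (ℓ := ℓ) hw hw0 hWb i j (hc 1) (hc 2)
    have hk := lintegral_cellN_kernel_mul_mul_le hℓ hij hwEm hrow hcol (hc 2) (hc 1) h2j h1i
    have hcomm : ∫⁻ X in cellN n ℓ, wE (X i) (X j) * ((‖pc 1 X‖₊ : ℝ≥0∞) * ‖pc 2 X‖₊) =
        ∫⁻ X in cellN n ℓ, wE (X i) (X j) * ((‖pc 2 X‖₊ : ℝ≥0∞) * ‖pc 1 X‖₊) :=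
      lintegral_congr fun X => by rw [mul_comm (‖pc 1 X‖₊ : ℝ≥0∞)]
    rw [← hcomm] at hk
    have hfin : (ENNReal.ofReal ℓ ^ 3)⁻¹ * M * ((∫⁻ X in cellN n ℓ, (‖pc 2 X‖₊ : ℝ≥0∞) ^ 2) +
        ∫⁻ X in cellN n ℓ, (‖pc 1 X‖₊ : ℝ≥0∞) ^ 2) ≠ ⊤ :=
      ENNReal.mul_ne_top hcoef (ENNReal.add_ne_top.2 ⟨hNtop 2, hNtop 1⟩)
    have hr := ENNReal.toReal_mono hfin hk
    rw [ENNReal.toReal_mul, ENNReal.toReal_ofNat, ENNReal.toReal_mul, hcoefr,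
      ENNReal.toReal_add (hNtop 2) (hNtop 1)] at hr
    simp only [hwE] at hr
    linarith
  -- (b13), (b23) the three-`Q` blocks
  have hεE : ENNReal.ofReal ε ≠ 0 := by rwa [Ne, ENNReal.ofReal_eq_zero, not_le]
  have hεE' : ENNReal.ofReal ε ≠ ⊤ := ENNReal.ofReal_ne_top
  have hεinv : (ENNReal.ofReal ε)⁻¹ = ENNReal.ofReal ε⁻¹ := (ENNReal.ofReal_inv_of_pos hε).symm
  have hW3top : ∫⁻ X in cellN n ℓ, wE (X i) (X j) * (‖pc 3 X‖₊ : ℝ≥0∞) ^ 2 ≠ ⊤ := by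
    have h := setLIntegral_cellN_weight_normSq_lt_top (hc 3) ℓ (m := fun _ : Space => ENNReal.ofReal Wb)
      ENNReal.ofReal_ne_top (fun _ => le_rfl) i
    refine ne_top_of_le_ne_top h.ne (lintegral_mono fun X => mul_le_mul' ?_ le_rfl)
    exact ENNReal.ofReal_le_ofReal ((le_abs_self _).trans (hWb _ _))
  have h13 : 2 * |∫ X in cellN n ℓ, w (X i) (X j) * (conj (pc 1 X) * pc 3 X).re| ≤
      ε * (∫ X in cellN n ℓ, w (X i) (X j) * ‖pc 3 X‖ ^ 2) +
        ε⁻¹ * (((ℓ ^ 3)⁻¹ * M.toReal) * (∫⁻ X in cellN n ℓ, (‖pc 1 X‖₊ : ℝ≥0∞) ^ 2).toReal) := by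
    have ha := abs_offdiag_block_le_toReal (ℓ := ℓ) hw hw0 hWb i j (hc 1) (hc 3)
    have hcs := two_lintegral_weight_mul_mul_le (μ := volume.restrict (cellN n ℓ)) hwEij
      (hc 3).measurable (hc 1).measurable hεE hεE'
    have hcomm : ∫⁻ X in cellN n ℓ, wE (X i) (X j) * ((‖pc 1 X‖₊ : ℝ≥0∞) * ‖pc 3 X‖₊) =
        ∫⁻ X in cellN n ℓ, wE (X i) (X j) * ((‖pc 3 X‖₊ : ℝ≥0∞) * ‖pc 1 X‖₊) :=
      lintegral_congr fun X => by rw [mul_comm (‖pc 1 X‖₊ : ℝ≥0∞)]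
    rw [← hcomm] at hcs
    -- the `pc 1` term: integrate out `xᵢ` (swap the roles of `i` and `j`)
    have hdum := lintegral_weight_normSq_le_of_update_invariant hℓ (Ne.symm hij) hwEm' hcol (hc 1) h1i
    have hfin : ENNReal.ofReal ε * (∫⁻ X in cellN n ℓ, wE (X i) (X j) * (‖pc 3 X‖₊ : ℝ≥0∞) ^ 2) +
        (ENNReal.ofReal ε)⁻¹ * ((ENNReal.ofReal ℓ ^ 3)⁻¹ * M *
          ∫⁻ X in cellN n ℓ, (‖pc 1 X‖₊ : ℝ≥0∞) ^ 2) ≠ ⊤ := by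
      rw [hεinv]
      exact ENNReal.add_ne_top.2 ⟨ENNReal.mul_ne_top hεE' hW3top,
        ENNReal.mul_ne_top ENNReal.ofReal_ne_top (ENNReal.mul_ne_top hcoef (hNtop 1))⟩
    have hle : 2 * ∫⁻ X in cellN n ℓ, wE (X i) (X j) * ((‖pc 1 X‖₊ : ℝ≥0∞) * ‖pc 3 X‖₊) ≤
        ENNReal.ofReal ε * (∫⁻ X in cellN n ℓ, wE (X i) (X j) * (‖pc 3 X‖₊ : ℝ≥0∞) ^ 2) +
          (ENNReal.ofReal ε)⁻¹ * ((ENNReal.ofReal ℓ ^ 3)⁻¹ * M *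
            ∫⁻ X in cellN n ℓ, (‖pc 1 X‖₊ : ℝ≥0∞) ^ 2) :=
      hcs.trans (add_le_add le_rfl (by gcongr))
    have hr := ENNReal.toReal_mono hfin hle
    rw [hεinv, ENNReal.toReal_mul, ENNReal.toReal_ofNat, ENNReal.toReal_add
        (ENNReal.mul_ne_top hεE' hW3top)
        (ENNReal.mul_ne_top ENNReal.ofReal_ne_top (ENNReal.mul_ne_top hcoef (hNtop 1))),
      ENNReal.toReal_mul, ENNReal.toReal_ofReal hε.le, ENNReal.toReal_mul,
      ENNReal.toReal_ofReal (inv_nonneg.2 hε.le), ENNReal.toReal_mul, hcoefr] at hr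
    simp only [hwE] at hr hD3e
    rw [← hD3e] at hr
    linarith
  have h23 : 2 * |∫ X in cellN n ℓ, w (X i) (X j) * (conj (pc 2 X) * pc 3 X).re| ≤
      ε * (∫ X in cellN n ℓ, w (X i) (X j) * ‖pc 3 X‖ ^ 2) +
        ε⁻¹ * (((ℓ ^ 3)⁻¹ * M.toReal) * (∫⁻ X in cellN n ℓ, (‖pc 2 X‖₊ : ℝ≥0∞) ^ 2).toReal) := by
    have ha := abs_offdiag_block_le_toReal (ℓ := ℓ) hw hw0 hWb i j (hc 2) (hc 3)
    have hcs := two_lintegral_weight_mul_mul_le (μ := volume.restrict (cellN n ℓ)) hwEij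
      (hc 3).measurable (hc 2).measurable hεE hεE'
    have hcomm : ∫⁻ X in cellN n ℓ, wE (X i) (X j) * ((‖pc 2 X‖₊ : ℝ≥0∞) * ‖pc 3 X‖₊) =
        ∫⁻ X in cellN n ℓ, wE (X i) (X j) * ((‖pc 3 X‖₊ : ℝ≥0∞) * ‖pc 2 X‖₊) :=
      lintegral_congr fun X => by rw [mul_comm (‖pc 2 X‖₊ : ℝ≥0∞)]
    rw [← hcomm] at hcs
    -- the `pc 2` term: integrate out `xⱼ`
    have hdum := lintegral_weight_normSq_le_of_update_invariant hℓ hij hwEm hrow (hc 2) h2j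
    have hfin : ENNReal.ofReal ε * (∫⁻ X in cellN n ℓ, wE (X i) (X j) * (‖pc 3 X‖₊ : ℝ≥0∞) ^ 2) +
        (ENNReal.ofReal ε)⁻¹ * ((ENNReal.ofReal ℓ ^ 3)⁻¹ * M *
          ∫⁻ X in cellN n ℓ, (‖pc 2 X‖₊ : ℝ≥0∞) ^ 2) ≠ ⊤ := by
      rw [hεinv]
      exact ENNReal.add_ne_top.2 ⟨ENNReal.mul_ne_top hεE' hW3top,
        ENNReal.mul_ne_top ENNReal.ofReal_ne_top (ENNReal.mul_ne_top hcoef (hNtop 2))⟩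
    have hle : 2 * ∫⁻ X in cellN n ℓ, wE (X i) (X j) * ((‖pc 2 X‖₊ : ℝ≥0∞) * ‖pc 3 X‖₊) ≤
        ENNReal.ofReal ε * (∫⁻ X in cellN n ℓ, wE (X i) (X j) * (‖pc 3 X‖₊ : ℝ≥0∞) ^ 2) +
          (ENNReal.ofReal ε)⁻¹ * ((ENNReal.ofReal ℓ ^ 3)⁻¹ * M *
            ∫⁻ X in cellN n ℓ, (‖pc 2 X‖₊ : ℝ≥0∞) ^ 2) :=
      hcs.trans (add_le_add le_rfl (by gcongr))
    have hr := ENNReal.toReal_mono hfin hle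
    rw [hεinv, ENNReal.toReal_mul, ENNReal.toReal_ofNat, ENNReal.toReal_add
        (ENNReal.mul_ne_top hεE' hW3top)
        (ENNReal.mul_ne_top ENNReal.ofReal_ne_top (ENNReal.mul_ne_top hcoef (hNtop 2))),
      ENNReal.toReal_mul, ENNReal.toReal_ofReal hε.le, ENNReal.toReal_mul,
      ENNReal.toReal_ofReal (inv_nonneg.2 hε.le), ENNReal.toReal_mul, hcoefr] at hr
    simp only [hwE] at hr hD3e
    rw [← hD3e] at hr
    linarith
  -- assemble
  exact pair_lowerBound_arith hE hD3 hε2 h12 h13 h23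

end Literature.MathematicalPhysics.QuantumManyBody.JelliumBoseGas
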